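import Summits.Ventures.LatticeQCDFlow.Exactness.IMHColdStartBurnIn
import HarnessLib

/-!
# Discard, do not average: the exact bias of a cold-started run after a burn-in of `b` steps, and the exact
# cold-start variance

HONEST FRAMING: exact (Metropolis-corrected) sampling algorithms for lattice gauge theory;
figures of merit are autocorrelation/cost numbers at stated couplings and volumes; no
continuum-physics claim.

Venture `LatticeQCDFlow` (cell pub-lqcd), topic `Exactness`; FANOUT row 30 (lean-1, GEN-31).  NEW WORK of the
cell, general state space; sequel of `IMHModeRenewal` / `IMHColdStartBurnIn` (this generation).  There the
flow-MCMC chain `K = indepMH q w` started at a mode `x₀` of the normalised weight was shown to have law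
`(1 − r^t)·π + r^t·δ_{x₀}` (`r = 1 − 1/w(x₀)`), and the time average of the first `T` steps to be biased by
`(f(x₀) − π f)·S_T/T ≍ (f(x₀) − π f)/(1 + T/w(x₀))` — polynomial forgetting.  The practitioner's alternative is to
DISCARD `b` steps and average the next `T`.  Here:

* §1 **`sum_Ico_integral_iterate_bind_indepMH_dirac_mode_sub`** — the summed bias of the window `[b, b+T)` is
  EXACTLY `(f(x₀) − π f)·r^b·S_T`: discarding `b` steps multiplies the whole burn-in law by the holding probability
  `r^b`; with `IMHColdStartBurnIn`'s ceiling, **`abs_sum_Ico_bias_mode_le`**: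
  `|Σ_{b≤t<b+T} bias_t| ≤ |f(x₀) − π f|·r^b·min(T, w(x₀))`.
* §2 **`abs_sum_Ico_bias_mode_le_of_log_le`** — `b ≥ w(x₀)·log(1/ε)` discarded steps make the time-average bias of
  EVERY observable `≤ ε·|f(x₀) − π f|` for EVERY window length `T` (`r^b ≤ e^{−b/w(x₀)} ≤ ε`), where WITHOUT
  discarding `T ≥ (1 − ε)·w(x₀)/ε` averaged steps are necessary (`IMHColdStartBurnIn.weight_le_of_sum_bias_mode_le`):
  DISCARD `w(x₀)·log(1/ε)`, DO NOT AVERAGE `w(x₀)/ε`.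
* §3 **`variance_iterate_bind_indepMH_dirac_mode`** — the exact cold-start VARIANCE at time `t` of a
  square-integrable observable: `Var_{δ_{x₀}K^t}(f) = (1 − r^t)·Var_π(f) + r^t(1 − r^t)·(f(x₀) − π f)²` — the
  stationary variance thinned by the melt probability plus the Bernoulli variance of "frozen or not".

NOT CLAIMED: covariances between times (the mean-square error of the window average needs two-time laws);
non-modal starts.

No `sorry`, no new definitions, nothing cited as a fact.
-/

noncomputable section

namespace Summit.Ventures.LatticeQCDFlow.Exactness

open MeasureTheory ProbabilityTheory Function Finset
open scoped ENNReal

variable {Ω : Type*} [MeasurableSpace Ω] [MeasurableSingletonClass Ω]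
variable {q : Measure Ω} [IsProbabilityMeasure q] {w : Ω → ℝ}

/-! ## §1 The window `[b, b + T)`: the burn-in law times `r^b` -/

/-- **THE EXACT BIAS AFTER DISCARDING `b` STEPS**: `Σ_{b ≤ t < b+T} (E_{x₀} f(X_t) − π f) = (f(x₀) − π f)·r^b·S_T`,
`S_T = Σ_{t<T} r^t`, `r = 1 − 1/w(x₀)`. [ours] -/
theorem sum_Ico_integral_iterate_bind_indepMH_dirac_mode_sub (hw : Measurable w) (hw0 : ∀ y, 0 < w y) {x₀ : Ω}
    (hmax : ∀ y, w y ≤ w x₀) [IsProbabilityMeasure (q.withDensity fun y => ENNReal.ofReal (w y))] (b T : ℕ)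
    {f : Ω → ℝ} (hf : Integrable f (q.withDensity fun y => ENNReal.ofReal (w y))) :
    ∑ t ∈ Ico b (b + T), (∫ x, f x ∂((fun m : Measure Ω => m.bind (indepMH q w))^[t] (Measure.dirac x₀)) -
        ∫ x, f x ∂(q.withDensity fun y => ENNReal.ofReal (w y))) =
      (f x₀ - ∫ x, f x ∂(q.withDensity fun y => ENNReal.ofReal (w y))) *
        ((1 - (w x₀)⁻¹) ^ b * ∑ t ∈ range T, (1 - (w x₀)⁻¹) ^ t) := by
  rw [Finset.sum_Ico_eq_sum_range, Nat.add_sub_cancel_left, mul_sum, mul_sum]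
  refine sum_congr rfl fun t _ => ?_
  rw [integral_iterate_bind_indepMH_dirac_mode_sub hw hw0 hmax (b + t) hf, pow_add]
  ring

/-- **Ceiling after discarding**: `|Σ_{b ≤ t < b+T} bias_t| ≤ |f(x₀) − π f|·r^b·min(T, w(x₀))`. [ours] -/
theorem abs_sum_Ico_bias_mode_le (hw : Measurable w) (hw0 : ∀ y, 0 < w y) {x₀ : Ω}
    (hmax : ∀ y, w y ≤ w x₀) [IsProbabilityMeasure (q.withDensity fun y => ENNReal.ofReal (w y))] (b T : ℕ)
    {f : Ω → ℝ} (hf : Integrable f (q.withDensity fun y => ENNReal.ofReal (w y))) :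
    |∑ t ∈ Ico b (b + T), (∫ x, f x ∂((fun m : Measure Ω => m.bind (indepMH q w))^[t] (Measure.dirac x₀)) -
        ∫ x, f x ∂(q.withDensity fun y => ENNReal.ofReal (w y)))| ≤
      |f x₀ - ∫ x, f x ∂(q.withDensity fun y => ENNReal.ofReal (w y))| *
        ((1 - (w x₀)⁻¹) ^ b * min (T : ℝ) (w x₀)) := by
  have hW : 1 ≤ w x₀ := one_le_of_mode (q := q) hmax
  have hr0 : 0 ≤ 1 - (w x₀)⁻¹ := sub_nonneg.2 (inv_le_one_of_one_le₀ hW)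
  have hS0 : 0 ≤ ∑ t ∈ range T, (1 - (w x₀)⁻¹) ^ t := sum_nonneg fun t _ => pow_nonneg hr0 t
  rw [sum_Ico_integral_iterate_bind_indepMH_dirac_mode_sub hw hw0 hmax b T hf, abs_mul,
    abs_of_nonneg (mul_nonneg (pow_nonneg hr0 b) hS0)]
  refine mul_le_mul_of_nonneg_left (mul_le_mul_of_nonneg_left ?_ (pow_nonneg hr0 b)) (abs_nonneg _)
  exact le_min (geom_sum_mode_le_card (q := q) hw0 hmax T) (geom_sum_mode_le_weight (q := q) hw0 hmax T)

/-! ## §2 Discard `w(x₀)·log(1/ε)` steps: relative bias `ε` for every window length -/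

omit [MeasurableSingletonClass Ω] in
/-- `r^b ≤ ε` once `b/w(x₀) ≥ log(1/ε)` (`r = 1 − 1/w(x₀) ≤ e^{−1/w(x₀)}`). [ours] -/
theorem pow_mode_le_of_log_le {x₀ : Ω} (hmax : ∀ y, w y ≤ w x₀)
    [IsProbabilityMeasure (q.withDensity fun y => ENNReal.ofReal (w y))] {b : ℕ} {ε : ℝ} (hε : 0 < ε)
    (hb : Real.log (1 / ε) ≤ b * (w x₀)⁻¹) : (1 - (w x₀)⁻¹) ^ b ≤ ε := by
  have hW : 1 ≤ w x₀ := one_le_of_mode (q := q) hmax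
  have hr0 : 0 ≤ 1 - (w x₀)⁻¹ := sub_nonneg.2 (inv_le_one_of_one_le₀ hW)
  have h1 : (1 - (w x₀)⁻¹) ^ b ≤ Real.exp (-(w x₀)⁻¹) ^ b := by
    refine pow_le_pow_left₀ hr0 ?_ b
    have := Real.add_one_le_exp (-(w x₀)⁻¹)
    linarith
  rw [← Real.exp_nat_mul] at h1
  refine h1.trans ?_
  have h2 : (b : ℝ) * -(w x₀)⁻¹ ≤ Real.log ε := by
    rw [one_div, Real.log_inv] at hb
    linarith
  calc Real.exp (b * -(w x₀)⁻¹) ≤ Real.exp (Real.log ε) := Real.exp_le_exp.2 h2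
    _ = ε := Real.exp_log hε

/-- **DISCARD `w(x₀)·log(1/ε)` STEPS AND THE TIME-AVERAGE BIAS OF EVERY OBSERVABLE IS AT MOST `ε·|f(x₀) − π f|`,
FOR EVERY WINDOW LENGTH `T`** — against the `(1 − ε)·w(x₀)/ε` averaged steps that are necessary without discarding
(`IMHColdStartBurnIn.weight_le_of_sum_bias_mode_le`). [ours] -/
theorem abs_sum_Ico_bias_mode_le_of_log_le (hw : Measurable w) (hw0 : ∀ y, 0 < w y) {x₀ : Ω}
    (hmax : ∀ y, w y ≤ w x₀) [IsProbabilityMeasure (q.withDensity fun y => ENNReal.ofReal (w y))] {b : ℕ} (T : ℕ)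
    {ε : ℝ} (hε : 0 < ε) (hb : Real.log (1 / ε) ≤ b * (w x₀)⁻¹)
    {f : Ω → ℝ} (hf : Integrable f (q.withDensity fun y => ENNReal.ofReal (w y))) :
    |∑ t ∈ Ico b (b + T), (∫ x, f x ∂((fun m : Measure Ω => m.bind (indepMH q w))^[t] (Measure.dirac x₀)) -
        ∫ x, f x ∂(q.withDensity fun y => ENNReal.ofReal (w y)))| ≤
      ε * T * |f x₀ - ∫ x, f x ∂(q.withDensity fun y => ENNReal.ofReal (w y))| := by
  have hpow := pow_mode_le_of_log_le (q := q) hmax hε hb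
  have h := abs_sum_Ico_bias_mode_le hw hw0 hmax b T hf
  have hmin : min (T : ℝ) (w x₀) ≤ T := min_le_left _ _
  have hT0 : (0 : ℝ) ≤ T := Nat.cast_nonneg T
  calc _ ≤ |f x₀ - ∫ x, f x ∂(q.withDensity fun y => ENNReal.ofReal (w y))| *
        ((1 - (w x₀)⁻¹) ^ b * min (T : ℝ) (w x₀)) := h
    _ ≤ |f x₀ - ∫ x, f x ∂(q.withDensity fun y => ENNReal.ofReal (w y))| * (ε * T) := by
        refine mul_le_mul_of_nonneg_left ?_ (abs_nonneg _)
        exact mul_le_mul hpow hmin (le_min hT0 (hw0 x₀).le) hε.le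
    _ = ε * T * |f x₀ - ∫ x, f x ∂(q.withDensity fun y => ENNReal.ofReal (w y))| := by ring

/-! ## §3 The exact cold-start variance -/

/-- **THE EXACT COLD-START VARIANCE**: for `f` with `f` and `f²` `π`-integrable,
`E_{x₀}[f(X_t)²] − (E_{x₀} f(X_t))² = (1 − r^t)·(π(f²) − π(f)²) + r^t(1 − r^t)·(f(x₀) − π f)²`. [ours] -/
theorem variance_iterate_bind_indepMH_dirac_mode (hw : Measurable w) (hw0 : ∀ y, 0 < w y) {x₀ : Ω}
    (hmax : ∀ y, w y ≤ w x₀) [IsProbabilityMeasure (q.withDensity fun y => ENNReal.ofReal (w y))] (t : ℕ)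
    {f : Ω → ℝ} (hf : Integrable f (q.withDensity fun y => ENNReal.ofReal (w y)))
    (hf2 : Integrable (fun x => f x ^ 2) (q.withDensity fun y => ENNReal.ofReal (w y))) :
    ∫ x, f x ^ 2 ∂((fun m : Measure Ω => m.bind (indepMH q w))^[t] (Measure.dirac x₀)) -
        (∫ x, f x ∂((fun m : Measure Ω => m.bind (indepMH q w))^[t] (Measure.dirac x₀))) ^ 2 =
      (1 - (1 - (w x₀)⁻¹) ^ t) *
          (∫ x, f x ^ 2 ∂(q.withDensity fun y => ENNReal.ofReal (w y)) -
            (∫ x, f x ∂(q.withDensity fun y => ENNReal.ofReal (w y))) ^ 2) +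
        (1 - (w x₀)⁻¹) ^ t * (1 - (1 - (w x₀)⁻¹) ^ t) *
          (f x₀ - ∫ x, f x ∂(q.withDensity fun y => ENNReal.ofReal (w y))) ^ 2 := by
  rw [integral_iterate_bind_indepMH_dirac_mode hw hw0 hmax t hf2, integral_iterate_bind_indepMH_dirac_mode hw hw0 hmax t hf]
  ring

end Summit.Ventures.LatticeQCDFlow.Exactness
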